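import Mathlib
import HarnessLib
import Summits.QuantumFields.YangMills.Theses.PencilRigidity
import Literature.MathematicalPhysics.QuantumFieldTheory.OSReconstructionNoE1Proofs
import Summits.QuantumFields.YangMills.Theorems.PencilRigidityCurvatureKernelBoundChartDerivativeBoundsCore
/-!
# `CurvatureKernelBound` — stub H `HalfSpaceKernel`, one-point field vectors and the kernel-value functional

(support for stmt-QuantumFields-11687, line `sixteen-charts-analytic-kernel`, skeleton v11; first half of the
`ScaledBumpsExist` helper file, split off for size: sections B–C; section D and the registered sub-goal
`ScaledBumpsExist` are in `…HalfSpaceKernelBumps`.)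
-/

noncomputable section

open scoped BigOperators Topology SchwartzMap ComplexConjugate InnerProductSpace
open MeasureTheory Filter Set Metric
open Literature.MathematicalPhysics.QuantumLattice Literature.MathematicalPhysics.AQFT
open Literature.MathematicalPhysics.QuantumFieldTheory
open Literature.MathematicalPhysics.QuantumLattice.SchwingerFamily (timeVec)

namespace Summit.QuantumFields.YangMills.Theorems.CurvatureKernel
/-! ## B. One-point field vectors in the OS Hilbert space of a one-species family -/

section FieldVec

variable {S : SchwingerFamily (EuclideanSpace ℝ (Fin 4))} (h : OSReconstructionNoE1 S.toLabelled)

/-- `t e₀ + a⃗ = a` when `t = a⁰`. [folklore] -/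
theorem timeVec_add_spatialPart_eq (c : EuclideanSpace ℝ (Fin 4)) :
    (timeVec (c 0) : EuclideanSpace ℝ (Fin 4)) + spatialPart 0 c = c := by
  ext i
  by_cases hi : i = 0
  · subst hi; simp [timeVec]
  · simp [timeVec, hi]

/-- Field vectors of equal one-point test functions agree. [folklore] -/
theorem fieldVec_one_congr {F G : 𝓢((Fin 1 → EuclideanSpace ℝ (Fin 4)), ℂ)} (hFG : F = G)
    (hF : IsTimeOrdered F) (hG : IsTimeOrdered G) :
    h.fieldVec 1 (fun _ => ()) F hF = h.fieldVec 1 (fun _ => ()) G hG := by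
  subst hFG
  rfl

/-- The translate of a one-point lift is the lift of the translate. [folklore] -/
theorem translateMulti_tensorFin_one (a : EuclideanSpace ℝ (Fin 4)) (χ : 𝓢(EuclideanSpace ℝ (Fin 4), ℂ)) :
    translateMulti a (SchwartzMap.tensorFin 1 ![χ]) =
      SchwartzMap.tensorFin 1 ![SchwartzMap.compSubConstCLM ℂ a χ] := by
  ext x
  rw [translateMulti_apply, tensorFin_one_eval, tensorFin_one_eval]
  simp [SchwartzMap.compSubConstCLM_apply]

/-- **`T(c) Ψ_χ = Ψ_{χ(· − c)}`**: the space-time translation `e^{-c⁰H} U(c⃗)` of the field vector of a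
positive-time one-point test function is the field vector of its translate (`c⁰ ≥ 0`). [folklore] -/
theorem transfer_translate_fieldVec_one {χ : 𝓢(EuclideanSpace ℝ (Fin 4), ℂ)}
    (hχ : tsupport (χ : EuclideanSpace ℝ (Fin 4) → ℂ) ⊆ {y | 0 < y 0}) {c : EuclideanSpace ℝ (Fin 4)} (hc : 0 ≤ c 0)
    (hχc : tsupport ((SchwartzMap.compSubConstCLM ℂ c χ : 𝓢(EuclideanSpace ℝ (Fin 4), ℂ)) :
      EuclideanSpace ℝ (Fin 4) → ℂ) ⊆ {y | 0 < y 0}) :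
    h.transfer (c 0) (h.translate c (h.fieldVec 1 (fun _ => ()) _ (isTimeOrdered_tensorFin_one hχ))) =
      h.fieldVec 1 (fun _ => ()) _ (isTimeOrdered_tensorFin_one hχc) := by
  rw [h.translate_fieldVec, h.transfer_fieldVec hc]
  refine fieldVec_one_congr h ?_ _ _
  rw [translateMulti_translateMulti, timeVec_add_spatialPart_eq, translateMulti_tensorFin_one]

/-- **`⟪Ψ_φ, e^{-tH} U(a⃗) Ψ_χ⟫ = 𝔖₂((conj∘φ∘θ) ⊗ χ(· − t e₀ − a⃗))`** for `t ≥ 0`. [folklore] -/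
theorem inner_fieldVec_transfer_translate {φ χ : 𝓢(EuclideanSpace ℝ (Fin 4), ℂ)}
    (hφ : tsupport (φ : EuclideanSpace ℝ (Fin 4) → ℂ) ⊆ {y | 0 < y 0})
    (hχ : tsupport (χ : EuclideanSpace ℝ (Fin 4) → ℂ) ⊆ {y | 0 < y 0}) {t : ℝ} (ht : 0 ≤ t)
    (a : EuclideanSpace ℝ (Fin 4)) :
    ⟪h.fieldVec 1 (fun _ => ()) _ (isTimeOrdered_tensorFin_one hφ),
        h.transfer t (h.translate a (h.fieldVec 1 (fun _ => ()) _ (isTimeOrdered_tensorFin_one hχ)))⟫_ℂ =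
      S 2 (SchwartzMap.tensorFin 2 ![starTest (thetaTest 4 φ),
        SchwartzMap.compSubConstCLM ℂ ((timeVec t : EuclideanSpace ℝ (Fin 4)) + spatialPart 0 a) χ]) := by
  rw [h.translate_fieldVec, h.transfer_fieldVec ht]
  have hw := isAppendTensorOf_conjTheta_translate_right (d := 4) φ χ ((timeVec t : EuclideanSpace ℝ (Fin 4)) + spatialPart 0 a)
  rw [← translateMulti_translateMulti] at hw
  rw [h.inner_fieldVec_fieldVec (fun _ => ()) (fun _ => ()) _ _ hw]
  rfl

/-- **Adjoint form**: `⟪Φ, e^{-tH} U(a⃗) w⟫ = ⟪U(−a⃗) e^{-tH} Φ, w⟫`. [folklore] -/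
theorem inner_transfer_translate_eq_inner_adjoint (Φ w : h.Hilbert) (t : ℝ) (a : EuclideanSpace ℝ (Fin 4)) :
    ⟪Φ, h.transfer t (h.translate a w)⟫_ℂ = ⟪h.translate (-a) (h.transfer t Φ), w⟫_ℂ := by
  rw [← h.inner_transfer_left]
  have h1 : h.translate (-a) (h.translate a w) = w := by
    rw [← h.translate_add_apply, neg_add_cancel, h.translate_zero_apply]
  have h2 : ⟪h.translate (-a) (h.transfer t Φ), w⟫_ℂ =
      ⟪h.translate (-a) (h.transfer t Φ), h.translate (-a) (h.translate a w)⟫_ℂ := by rw [h1]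
  rw [h2, LinearIsometryEquiv.inner_map_map]

/-- **Joint strong continuity** of `c ↦ U(−c⃗) e^{-c⁰H} Φ`. [folklore] -/
theorem continuous_translate_neg_transfer (Φ : h.Hilbert) :
    Continuous fun c : EuclideanSpace ℝ (Fin 4) => h.translate (-c) (h.transfer (c 0) Φ) := by
  have h1 : Continuous fun c : EuclideanSpace ℝ (Fin 4) => h.transfer (c 0) Φ :=
    (h.continuous_transfer_apply Φ).comp (EuclideanSpace.proj (0 : Fin 4)).continuous
  -- `‖U(-c)ψ − U(-c')ψ'‖ ≤ ‖U(-c)ψ − U(-c')ψ‖ + ‖ψ − ψ'‖`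
  rw [continuous_iff_continuousAt]
  intro c
  rw [ContinuousAt, tendsto_iff_norm_sub_tendsto_zero]
  have hb : ∀ c' : EuclideanSpace ℝ (Fin 4),
      ‖h.translate (-c') (h.transfer (c' 0) Φ) - h.translate (-c) (h.transfer (c 0) Φ)‖ ≤
        ‖h.transfer (c' 0) Φ - h.transfer (c 0) Φ‖ +
          ‖h.translate (-c') (h.transfer (c 0) Φ) - h.translate (-c) (h.transfer (c 0) Φ)‖ := by
    intro c'
    have e : h.translate (-c') (h.transfer (c' 0) Φ) - h.translate (-c) (h.transfer (c 0) Φ) =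
        (h.translate (-c') (h.transfer (c' 0) Φ) - h.translate (-c') (h.transfer (c 0) Φ)) +
          (h.translate (-c') (h.transfer (c 0) Φ) - h.translate (-c) (h.transfer (c 0) Φ)) := by abel
    rw [e]
    refine (norm_add_le _ _).trans (add_le_add ?_ le_rfl)
    rw [← map_sub, LinearIsometryEquiv.norm_map]
  have h0 : Tendsto (fun c' : EuclideanSpace ℝ (Fin 4) => ‖h.transfer (c' 0) Φ - h.transfer (c 0) Φ‖ +
      ‖h.translate (-c') (h.transfer (c 0) Φ) - h.translate (-c) (h.transfer (c 0) Φ)‖) (𝓝 c) (𝓝 0) := by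
    have t1 : Tendsto (fun c' : EuclideanSpace ℝ (Fin 4) => ‖h.transfer (c' 0) Φ - h.transfer (c 0) Φ‖) (𝓝 c) (𝓝 0) := by
      have := ((h1.tendsto c).sub (tendsto_const_nhds (x := h.transfer (c 0) Φ))).norm
      simpa using this
    have t2 : Tendsto (fun c' : EuclideanSpace ℝ (Fin 4) =>
        ‖h.translate (-c') (h.transfer (c 0) Φ) - h.translate (-c) (h.transfer (c 0) Φ)‖) (𝓝 c) (𝓝 0) := by
      have h3 : Continuous fun c' : EuclideanSpace ℝ (Fin 4) => h.translate (-c') (h.transfer (c 0) Φ) :=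
        (h.continuous_translate_apply _).comp continuous_neg
      have := ((h3.tendsto c).sub (tendsto_const_nhds (x := h.translate (-c) (h.transfer (c 0) Φ)))).norm
      simpa using this
    simpa using t1.add t2
  exact squeeze_zero (fun _ => norm_nonneg _) hb h0

/-- **`‖Ψ_φ‖² = Re 𝔖₂((conj∘φ∘θ) ⊗ φ)`** for a positive-time one-point `φ`. [folklore] -/
theorem norm_fieldVec_one_sq {φ : 𝓢(EuclideanSpace ℝ (Fin 4), ℂ)}
    (hφ : tsupport (φ : EuclideanSpace ℝ (Fin 4) → ℂ) ⊆ {y | 0 < y 0}) :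
    ‖h.fieldVec 1 (fun _ => ()) _ (isTimeOrdered_tensorFin_one hφ)‖ ^ 2 =
      (S 2 (SchwartzMap.tensorFin 2 ![starTest (thetaTest 4 φ), φ])).re := by
  have h1 : ⟪h.fieldVec 1 (fun _ => ()) _ (isTimeOrdered_tensorFin_one hφ),
      h.fieldVec 1 (fun _ => ()) _ (isTimeOrdered_tensorFin_one hφ)⟫_ℂ =
      S 2 (SchwartzMap.tensorFin 2 ![starTest (thetaTest 4 φ), φ]) := by
    rw [h.inner_fieldVec_fieldVec (fun _ => ()) (fun _ => ()) _ _ (isAppendTensorOf_conjTheta φ φ)]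
    rfl
  rw [← h1, ← inner_self_eq_norm_sq (𝕜 := ℂ)]
  rfl

/-- **Linearity of `φ ↦ Ψ_φ` on positive-time one-point test functions** (the OS form kills the
difference): additivity. [folklore] -/
theorem fieldVec_one_add {φ χ : 𝓢(EuclideanSpace ℝ (Fin 4), ℂ)}
    (hφ : tsupport (φ : EuclideanSpace ℝ (Fin 4) → ℂ) ⊆ {y | 0 < y 0})
    (hχ : tsupport (χ : EuclideanSpace ℝ (Fin 4) → ℂ) ⊆ {y | 0 < y 0})
    (hφχ : tsupport ((φ + χ : 𝓢(EuclideanSpace ℝ (Fin 4), ℂ)) : EuclideanSpace ℝ (Fin 4) → ℂ) ⊆ {y | 0 < y 0}) :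
    h.fieldVec 1 (fun _ => ()) _ (isTimeOrdered_tensorFin_one hφχ) =
      h.fieldVec 1 (fun _ => ()) _ (isTimeOrdered_tensorFin_one hφ) +
        h.fieldVec 1 (fun _ => ()) _ (isTimeOrdered_tensorFin_one hχ) := by
  have hsum : SchwartzMap.tensorFin 1 ![φ + χ] = SchwartzMap.tensorFin 1 ![φ] + SchwartzMap.tensorFin 1 ![χ] := by
    ext x; simp
  rw [← sub_eq_zero, ← inner_self_eq_zero (𝕜 := ℂ)]
  simp only [inner_sub_left, inner_sub_right, inner_add_left, inner_add_right,
    h.inner_fieldVec_fieldVec _ _ _ _ (isAppendTensorOf_appendTensor _ _), hsum, osAdjoint_add,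
    SchwartzMap.appendTensor_add_left, SchwartzMap.appendTensor_add_right, map_add]
  ring

/-- Linearity of `φ ↦ Ψ_φ`: homogeneity. [folklore] -/
theorem fieldVec_one_smul (a : ℂ) {φ : 𝓢(EuclideanSpace ℝ (Fin 4), ℂ)}
    (hφ : tsupport (φ : EuclideanSpace ℝ (Fin 4) → ℂ) ⊆ {y | 0 < y 0})
    (haφ : tsupport ((a • φ : 𝓢(EuclideanSpace ℝ (Fin 4), ℂ)) : EuclideanSpace ℝ (Fin 4) → ℂ) ⊆ {y | 0 < y 0}) :
    h.fieldVec 1 (fun _ => ()) _ (isTimeOrdered_tensorFin_one haφ) =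
      a • h.fieldVec 1 (fun _ => ()) _ (isTimeOrdered_tensorFin_one hφ) := by
  have hsm : SchwartzMap.tensorFin 1 ![a • φ] = a • SchwartzMap.tensorFin 1 ![φ] := by
    ext x; simp
  rw [← sub_eq_zero, ← inner_self_eq_zero (𝕜 := ℂ)]
  simp only [inner_sub_left, inner_sub_right, inner_smul_left, inner_smul_right,
    h.inner_fieldVec_fieldVec _ _ _ _ (isAppendTensorOf_appendTensor _ _), hsm,
    Literature.MathematicalPhysics.QuantumLattice.osAdjoint_smul,
    SchwartzMap.appendTensor_smul_left, SchwartzMap.appendTensor_smul_right, map_smul, smul_eq_mul]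
  ring

/-- Linearity of `φ ↦ Ψ_φ`: subtraction. [folklore] -/
theorem fieldVec_one_sub {φ χ : 𝓢(EuclideanSpace ℝ (Fin 4), ℂ)}
    (hφ : tsupport (φ : EuclideanSpace ℝ (Fin 4) → ℂ) ⊆ {y | 0 < y 0})
    (hχ : tsupport (χ : EuclideanSpace ℝ (Fin 4) → ℂ) ⊆ {y | 0 < y 0})
    (hφχ : tsupport ((φ - χ : 𝓢(EuclideanSpace ℝ (Fin 4), ℂ)) : EuclideanSpace ℝ (Fin 4) → ℂ) ⊆ {y | 0 < y 0}) :
    h.fieldVec 1 (fun _ => ()) _ (isTimeOrdered_tensorFin_one hφχ) =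
      h.fieldVec 1 (fun _ => ()) _ (isTimeOrdered_tensorFin_one hφ) -
        h.fieldVec 1 (fun _ => ()) _ (isTimeOrdered_tensorFin_one hχ) := by
  have hneg : tsupport (((-1 : ℂ) • χ : 𝓢(EuclideanSpace ℝ (Fin 4), ℂ)) : EuclideanSpace ℝ (Fin 4) → ℂ) ⊆ {y | 0 < y 0} := by
    refine (tsupport_smul_subset_right (fun _ : EuclideanSpace ℝ (Fin 4) => (-1 : ℂ)) (χ : EuclideanSpace ℝ (Fin 4) → ℂ)).trans hχ
  have e1 : φ - χ = φ + (-1 : ℂ) • χ := by rw [neg_one_smul, sub_eq_add_neg]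
  have hφχ' : tsupport ((φ + (-1 : ℂ) • χ : 𝓢(EuclideanSpace ℝ (Fin 4), ℂ)) : EuclideanSpace ℝ (Fin 4) → ℂ) ⊆ {y | 0 < y 0} := by
    rw [← e1]; exact hφχ
  have := fieldVec_one_add h hφ hneg hφχ'
  rw [fieldVec_one_smul h (-1) hχ hneg] at this
  rw [fieldVec_one_congr h (by rw [e1]) (isTimeOrdered_tensorFin_one hφχ) (isTimeOrdered_tensorFin_one hφχ'), this,
    neg_one_smul, sub_eq_add_neg]

/-- **`Ψ_0 = 0`** for the zero one-point test function. [folklore] -/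
theorem fieldVec_one_zero (h0 : tsupport ((0 : 𝓢(EuclideanSpace ℝ (Fin 4), ℂ)) : EuclideanSpace ℝ (Fin 4) → ℂ) ⊆ {y | 0 < y 0}) :
    h.fieldVec 1 (fun _ => ()) _ (isTimeOrdered_tensorFin_one h0) = 0 := by
  rw [← norm_eq_zero, ← pow_eq_zero_iff two_ne_zero, norm_fieldVec_one_sq h h0]
  have : SchwartzMap.tensorFin 2 ![starTest (thetaTest 4 (0 : 𝓢(EuclideanSpace ℝ (Fin 4), ℂ))), (0 : 𝓢(EuclideanSpace ℝ (Fin 4), ℂ))] = 0 :=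
    tensorFin_two_zero_right _
  rw [this, map_zero, Complex.zero_re]

/-- The support of a finite sum of positive-time one-point test functions is positive-time. [folklore] -/
theorem tsupport_finset_sum_smul_subset_pos {ι : Type*} (t : Finset ι) (a : ι → ℂ) (f : ι → 𝓢(EuclideanSpace ℝ (Fin 4), ℂ))
    (hf : ∀ i, tsupport (f i : EuclideanSpace ℝ (Fin 4) → ℂ) ⊆ {y | 0 < y 0}) :
    tsupport ((∑ i ∈ t, a i • f i : 𝓢(EuclideanSpace ℝ (Fin 4), ℂ)) : EuclideanSpace ℝ (Fin 4) → ℂ) ⊆ {y | 0 < y 0} := by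
  classical
  induction t using Finset.induction_on with
  | empty =>
    intro y hy
    rw [Finset.sum_empty, (tsupport_eq_empty_iff (f := ((0 : 𝓢(EuclideanSpace ℝ (Fin 4), ℂ)) : EuclideanSpace ℝ (Fin 4) → ℂ))).2 rfl] at hy
    exact hy.elim
  | insert i t hi ih =>
    rw [Finset.sum_insert hi]
    refine (tsupport_add _ _).trans (Set.union_subset ?_ ih)
    exact (tsupport_smul_subset_right (fun _ : EuclideanSpace ℝ (Fin 4) => a i) (f i : EuclideanSpace ℝ (Fin 4) → ℂ)).trans (hf i)

/-- Linearity of `φ ↦ Ψ_φ` over finite sums of positive-time one-point test functions. [folklore] -/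
theorem fieldVec_one_finset_sum {ι : Type*} (s : Finset ι) (a : ι → ℂ) (f : ι → 𝓢(EuclideanSpace ℝ (Fin 4), ℂ))
    (hf : ∀ i, tsupport (f i : EuclideanSpace ℝ (Fin 4) → ℂ) ⊆ {y | 0 < y 0})
    (hs : tsupport ((∑ i ∈ s, a i • f i : 𝓢(EuclideanSpace ℝ (Fin 4), ℂ)) : EuclideanSpace ℝ (Fin 4) → ℂ) ⊆ {y | 0 < y 0}) :
    h.fieldVec 1 (fun _ => ()) _ (isTimeOrdered_tensorFin_one hs) =
      ∑ i ∈ s, a i • h.fieldVec 1 (fun _ => ()) _ (isTimeOrdered_tensorFin_one (hf i)) := by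
  classical
  have hpart := fun t : Finset ι => tsupport_finset_sum_smul_subset_pos t a f hf
  suffices H : ∀ t : Finset ι, h.fieldVec 1 (fun _ => ()) _ (isTimeOrdered_tensorFin_one (hpart t)) =
      ∑ i ∈ t, a i • h.fieldVec 1 (fun _ => ()) _ (isTimeOrdered_tensorFin_one (hf i)) by
    exact H s
  intro t
  induction t using Finset.induction_on with
  | empty =>
    conv_rhs => rw [Finset.sum_empty]
    have h0 : tsupport ((0 : 𝓢(EuclideanSpace ℝ (Fin 4), ℂ)) : EuclideanSpace ℝ (Fin 4) → ℂ) ⊆ {y | 0 < y 0} := by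
      intro y hy
      rw [(tsupport_eq_empty_iff (f := ((0 : 𝓢(EuclideanSpace ℝ (Fin 4), ℂ)) : EuclideanSpace ℝ (Fin 4) → ℂ))).2 rfl] at hy
      exact hy.elim
    rw [fieldVec_one_congr h (show SchwartzMap.tensorFin 1 ![∑ i ∈ (∅ : Finset ι), a i • f i] =
      SchwartzMap.tensorFin 1 ![(0 : 𝓢(EuclideanSpace ℝ (Fin 4), ℂ))] by rw [Finset.sum_empty]) _ (isTimeOrdered_tensorFin_one h0)]
    exact fieldVec_one_zero h h0
  | insert i t hi ih =>
    conv_rhs => rw [Finset.sum_insert hi]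
    have hai : tsupport ((a i • f i : 𝓢(EuclideanSpace ℝ (Fin 4), ℂ)) : EuclideanSpace ℝ (Fin 4) → ℂ) ⊆ {y | 0 < y 0} :=
      (tsupport_smul_subset_right (fun _ : EuclideanSpace ℝ (Fin 4) => a i) (f i : EuclideanSpace ℝ (Fin 4) → ℂ)).trans (hf i)
    have hsum' : tsupport ((a i • f i + ∑ j ∈ t, a j • f j : 𝓢(EuclideanSpace ℝ (Fin 4), ℂ)) :
        EuclideanSpace ℝ (Fin 4) → ℂ) ⊆ {y | 0 < y 0} := by
      have := hpart (insert i t); rwa [Finset.sum_insert hi] at this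
    rw [fieldVec_one_congr h (show SchwartzMap.tensorFin 1 ![∑ j ∈ insert i t, a j • f j] =
      SchwartzMap.tensorFin 1 ![a i • f i + ∑ j ∈ t, a j • f j] by rw [Finset.sum_insert hi]) _ (isTimeOrdered_tensorFin_one hsum'),
      fieldVec_one_add h hai (hpart t) hsum', fieldVec_one_smul h (a i) (hf i) hai, ih]

end FieldVec


/-! ## C. The kernel-value functional `ξ ↦ ⟪Ψ, e^{-(−ξ⁰−2p)H} U(−ξ⃗) Ψ⟫` -/

section KVal

variable {S : SchwingerFamily (EuclideanSpace ℝ (Fin 4))} (h : OSReconstructionNoE1 S.toLabelled)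

/-- **Joint strong continuity** of `x ↦ U(g x) e^{-(f x)H} Φ` for continuous `f`, `g`. [folklore] -/
theorem continuous_translate_transfer_comp {X : Type*} [TopologicalSpace X] (Φ : h.Hilbert)
    {f : X → ℝ} {g : X → EuclideanSpace ℝ (Fin 4)} (hf : Continuous f) (hg : Continuous g) :
    Continuous fun x => h.translate (g x) (h.transfer (f x) Φ) := by
  have h1 : Continuous fun x => h.transfer (f x) Φ := (h.continuous_transfer_apply Φ).comp hf
  rw [continuous_iff_continuousAt]
  intro c
  rw [ContinuousAt, tendsto_iff_norm_sub_tendsto_zero]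
  have hb : ∀ x, ‖h.translate (g x) (h.transfer (f x) Φ) - h.translate (g c) (h.transfer (f c) Φ)‖ ≤
      ‖h.transfer (f x) Φ - h.transfer (f c) Φ‖ +
        ‖h.translate (g x) (h.transfer (f c) Φ) - h.translate (g c) (h.transfer (f c) Φ)‖ := by
    intro x
    have e : h.translate (g x) (h.transfer (f x) Φ) - h.translate (g c) (h.transfer (f c) Φ) =
        (h.translate (g x) (h.transfer (f x) Φ) - h.translate (g x) (h.transfer (f c) Φ)) +
          (h.translate (g x) (h.transfer (f c) Φ) - h.translate (g c) (h.transfer (f c) Φ)) := by abel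
    rw [e]
    refine (norm_add_le _ _).trans (add_le_add ?_ le_rfl)
    rw [← map_sub, LinearIsometryEquiv.norm_map]
  have h0 : Tendsto (fun x => ‖h.transfer (f x) Φ - h.transfer (f c) Φ‖ +
      ‖h.translate (g x) (h.transfer (f c) Φ) - h.translate (g c) (h.transfer (f c) Φ)‖) (𝓝 c) (𝓝 0) := by
    have t1 : Tendsto (fun x => ‖h.transfer (f x) Φ - h.transfer (f c) Φ‖) (𝓝 c) (𝓝 0) := by
      have := ((h1.tendsto c).sub (tendsto_const_nhds (x := h.transfer (f c) Φ))).norm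
      simpa using this
    have t2 : Tendsto (fun x => ‖h.translate (g x) (h.transfer (f c) Φ) - h.translate (g c) (h.transfer (f c) Φ)‖) (𝓝 c) (𝓝 0) := by
      have h3 : Continuous fun x => h.translate (g x) (h.transfer (f c) Φ) := (h.continuous_translate_apply _).comp hg
      have := ((h3.tendsto c).sub (tendsto_const_nhds (x := h.translate (g c) (h.transfer (f c) Φ)))).norm
      simpa using this
    simpa using t1.add t2
  exact squeeze_zero (fun _ => norm_nonneg _) hb h0

/-- `|⟪Ψ, e^{-tH} U(a⃗) Ψ⟫| ≤ ‖Ψ‖²` (contraction and isometry). [folklore] -/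
theorem norm_inner_transfer_translate_le (Ψ : h.Hilbert) (t : ℝ) (a : EuclideanSpace ℝ (Fin 4)) :
    ‖⟪Ψ, h.transfer t (h.translate a Ψ)⟫_ℂ‖ ≤ ‖Ψ‖ ^ 2 := by
  refine (norm_inner_le_norm _ _).trans ?_
  rw [sq]
  refine mul_le_mul_of_nonneg_left ((h.norm_transfer_le t _).trans ?_) (norm_nonneg _)
  rw [LinearIsometryEquiv.norm_map]

/-- **Shifting the base vector**: `⟪e^{-δH}Ψ, e^{-tH}U(a⃗) e^{-δH}Ψ⟫ = ⟪Ψ, e^{-(t+2δ)H}U(a⃗)Ψ⟫`. [folklore] -/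
theorem inner_transfer_transfer_translate_transfer (Ψ : h.Hilbert) {δ t : ℝ} (hδ : 0 ≤ δ) (ht : 0 ≤ t)
    (a : EuclideanSpace ℝ (Fin 4)) :
    ⟪h.transfer δ Ψ, h.transfer t (h.translate a (h.transfer δ Ψ))⟫_ℂ = ⟪Ψ, h.transfer (t + 2 * δ) (h.translate a Ψ)⟫_ℂ := by
  rw [h.inner_transfer_left, h.translate_transfer]
  have e1 : h.transfer δ (h.transfer t (h.transfer δ (h.translate a Ψ))) =
      h.transfer (δ + (t + δ)) (h.translate a Ψ) := by
    rw [h.transfer_add hδ (by positivity), ContinuousLinearMap.comp_apply, h.transfer_add ht hδ,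
      ContinuousLinearMap.comp_apply]
  rw [e1]
  congr 2
  ring

end KVal


/-- **Sub-goal `KernelValueContinuity`** (helper for stub `HalfSpaceKernel`; registered signature): joint strong
continuity of `x ↦ U(g x) e^{-(f x)H} Φ` in the OS Hilbert space for continuous `f`, `g` (the continuity of the
kernel-value functional). [folklore] -/
theorem KernelValueContinuity : open Literature.MathematicalPhysics.QuantumLattice Literature.MathematicalPhysics.AQFT Literature.MathematicalPhysics.QuantumFieldTheory in ∀ {S : SchwingerFamily (EuclideanSpace ℝ (Fin 4))} (h : OSReconstructionNoE1 S.toLabelled) {X : Type*} [TopologicalSpace X] (Φ : h.Hilbert) {f : X → ℝ} {g : X → EuclideanSpace ℝ (Fin 4)}, Continuous f → Continuous g → Continuous fun x => h.translate (g x) (h.transfer (f x) Φ) := by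
  intro S h X _ Φ f g hf hg
  exact continuous_translate_transfer_comp h Φ hf hg

end Summit.QuantumFields.YangMills.Theorems.CurvatureKernel

end
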